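import Mathlib
import HarnessLib
import Summits.HubbardSuperconductivity.HubbardSuperconductivity.Theses.EnslavedA1g
import Summits.HubbardSuperconductivity.HubbardSuperconductivity.Theorems.EnslavedA1gIdentity
import Summits.HubbardSuperconductivity.HubbardSuperconductivity.Theorems.WeakCouplingBCSWcbcsSsbToTorusLROMomentClosure
import Summits.HubbardSuperconductivity.HubbardSuperconductivity.Theorems.WeakCouplingBCSWcbcsTowerTrialBudgetSlater
import Literature.MathematicalPhysics.QuantumLattice.HubbardRingPerronFrobeniusProofs
import Literature.MathematicalPhysics.QuantumLattice.HubbardModelProofs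
import Literature.MathematicalPhysics.QuantumLattice.HubbardHubbardModelEtaODLROProofs
import Literature.MathematicalPhysics.QuantumLattice.HubbardHubbardModelEtaPairingProofs
import Literature.MathematicalPhysics.QuantumLattice.FermionOperatorsEtaSpinProofs
import Literature.MathematicalPhysics.QuantumLattice.ShastryPairingInequalitiesProjectionProofs
import Literature.MathematicalPhysics.QuantumLattice.DopedRVBState
import Literature.MathematicalPhysics.QuantumLattice.HubbardWave0PosSemidefProofs

/-!
# Route `EnslavedA1g`, support `EnslavedA1gLowerSandwich` (item `stmt-HubbardSuperconductivity-0937`)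

LOWER SANDWICH + SIGN RULE. For `U ≥ 0`, `L` even with `L ≥ 3`, `2 ≤ N ≤ L²` and a normalised
ground state `ψ` of `H = hubbardTorus 2 L 1 U` in the joint sector `(N, S^z = 0)`, with
`κ := U - (E(N,0) - E(N-2,0))` (`E(M,0) = minEnergyOn H (szSector M 0)`):

* (i)   `0 ≤ κ` — Yang's `η`-pairing: `η†` (staggered, `ε_x = (-1)^{x₁+x₂}`, consistent for even `L`)
  maps a ground state `φ` of the sector `(N-2, 0)` (which exists, `szSector_groundState`) to an
  eigenvector `η†φ` of `H` in the sector `(N, 0)` with eigenvalue `E(N-2,0) + U`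
  (`[H, η†] = U η†`, `etaRaise_commutator_holds`), and `η†φ ≠ 0` because
  `‖η†φ‖² = ‖ηφ‖² + (L² - N + 2) ‖φ‖²` (`[η, η†] = L² - N̂`, `etaLower_mulVec_etaRaise_mulVec`);
  the variational principle in the sector `(N, 0)` gives `E(N,0) ≤ E(N-2,0) + U`.
* (ii)  `κ ‖P_s ψ‖² ≤ 2 Re⟨P_s ψ, P_{s'} ψ⟩` — by the enslaved-A1g identity
  (`enslavedA1gIdentity_proof`, item 0936) `2 P_{s'} ψ = (H - E(N,0) + U) P_s ψ` with
  `P_s ψ ∈ szSector (N-2) 0`, and the variational principle in the sector `(N-2, 0)`.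
* (iii) `κ² ‖P_s ψ‖² ≤ 4 ‖P_{s'} ψ‖²` — from (ii), `κ ≥ 0` and Cauchy–Schwarz.

Here `P_s = pairField sWave L`, `P_{s'} = pairField extendedSWave L`. This is the canonical-sector
version of Shastry's projected-pair inequalities (Shastry, J. Phys. A 30 (1997) L635, Ineqs. (3)–(5)
at `U_s = 0`, `2μ := E(N,0) - E(N-2,0)`; cf. `shastry_pair_projection_inequalities` in the tree) and
of Zhang's constraint (Zhang, PRB 42 (1990) 1012); the `η`-pairing bound is Yang, PRL 63 (1989) 2144.
All ingredients are proved tree lemmas; the bookkeeping here is folklore.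
-/

noncomputable section

namespace Summit.HubbardSuperconductivity.EnslavedA1g

open Matrix Finset
open Literature.Probability.LatticeModels Literature.MathematicalPhysics.QuantumLattice
open Summit.HubbardSuperconductivity.HubbardSuperconductivity.Theses.EnslavedA1g
open scoped ComplexOrder

/-! ### Linear-algebra helpers -/

section LinAlg

variable {n : Type*} [Fintype n]

/-- `⟨ψ, Aᴴ v⟩ = ⟨A ψ, v⟩` for the pairing `⟨u, w⟩ = star u ⬝ᵥ w`. [folklore] -/
theorem star_dotProduct_conjTranspose_mulVec (A : Matrix n n ℂ) (ψ v : n → ℂ) :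
    star ψ ⬝ᵥ (Aᴴ *ᵥ v) = star (A *ᵥ ψ) ⬝ᵥ v := by
  rw [dotProduct_mulVec, star_mulVec]

/-- `⟨ψ, A v⟩ = ⟨Aᴴ ψ, v⟩`. [folklore] -/
theorem star_dotProduct_mulVec_eq_conjTranspose (A : Matrix n n ℂ) (ψ v : n → ℂ) :
    star ψ ⬝ᵥ (A *ᵥ v) = star (Aᴴ *ᵥ ψ) ⬝ᵥ v := by
  rw [← star_dotProduct_conjTranspose_mulVec, conjTranspose_conjTranspose]

/-- `(2 • z).re = 2 z.re` for the complex scalar `2`. [folklore] -/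
theorem re_two_smul_dotProduct (u w : n → ℂ) :
    (star u ⬝ᵥ ((2 : ℂ) • w)).re = 2 * (star u ⬝ᵥ w).re := by
  rw [dotProduct_smul, smul_eq_mul]
  simp [Complex.mul_re]

end LinAlg

section Fock

variable {ι : Type*} [LinearOrder ι] [Fintype ι]

omit [LinearOrder ι] [Fintype ι] in
/-- On an `N`-particle vector the diagonal operator `|s⟩ ↦ (c - #s) |s⟩` acts as the scalar
`c - N`. [folklore] -/
theorem cardShift_apply_eq_smul {N : ℕ} {φ : Fock ι} (hφ : IsNParticle N φ) (c : ℂ) :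
    (fun s : Finset ι => (c - s.card) * φ s) = (c - N) • φ := by
  funext s
  rw [Pi.smul_apply, smul_eq_mul]
  by_cases hs : s.card = N
  · rw [hs]
  · rw [hφ s hs, mul_zero, mul_zero]

end Fock

/-! ### Yang's `η†` on the spin sectors -/

section Eta

variable {Λ : Type*} [LinearOrder Λ] [Fintype Λ]

/-- `η†_ε = Σ_x ε_x c†_{x↑} c†_{x↓}` raises `N↑` and `N↓` by one each: it maps Lieb's sector
`(a, b)` into `(a + 1, b + 1)`. Yang, PRL 63 (1989) 2144, eq. (4). [folklore] -/
theorem isInSector_etaRaise_mulVec {a b : ℕ} {φ : Fock (Orb Λ)} (hφ : IsInSector a b φ)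
    (ε : Λ → ℤˣ) : IsInSector (a + 1) (b + 1) (etaRaise ε *ᵥ φ) := by
  unfold etaRaise
  rw [sum_mulVec]
  refine IsInSector.sum fun x _ => ?_
  rw [smul_mulVec]
  exact (hφ.pairCreator_mulVec x x).smul _

/-- **`‖η† φ‖² = ‖η φ‖² + (|Λ| - N) ‖φ‖²`** for an `N`-particle vector `φ` (Yang's commutator
`[η, η†] = |Λ| - N̂`, `EtaPairingODLRO.etaLower_mulVec_etaRaise_mulVec`).
Yang, PRL 63 (1989) 2144, eq. (5). [folklore] -/
theorem star_etaRaise_mulVec_dotProduct_self (ε : Λ → ℤˣ) {N : ℕ} {φ : Fock (Orb Λ)}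
    (hφ : IsNParticle N φ) :
    star (etaRaise ε *ᵥ φ) ⬝ᵥ (etaRaise ε *ᵥ φ) =
      star (etaLower ε *ᵥ φ) ⬝ᵥ (etaLower ε *ᵥ φ) +
        ((Fintype.card Λ : ℂ) - N) * (star φ ⬝ᵥ φ) := by
  have h1 : star (etaRaise ε *ᵥ φ) ⬝ᵥ (etaRaise ε *ᵥ φ) =
      star φ ⬝ᵥ (etaLower ε *ᵥ (etaRaise ε *ᵥ φ)) := by
    rw [etaLower, star_dotProduct_conjTranspose_mulVec]
  have h2 : star φ ⬝ᵥ (etaRaise ε *ᵥ (etaLower ε *ᵥ φ)) =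
      star (etaLower ε *ᵥ φ) ⬝ᵥ (etaLower ε *ᵥ φ) := by
    rw [star_dotProduct_mulVec_eq_conjTranspose, etaLower]
  rw [h1, EtaPairingODLRO.etaLower_mulVec_etaRaise_mulVec, dotProduct_add, h2,
    cardShift_apply_eq_smul hφ, dotProduct_smul, smul_eq_mul]

end Eta

/-! ### The main theorem -/

section Main

variable {L : ℕ} [NeZero L]

omit [NeZero L] in
/-- **Yang's sector inequality** `E(2m+2, 0) ≤ E(2m, 0) + U` for the Hubbard Hamiltonian on the
torus `(ℤ/Lℤ)²` of even side, `2m + 2 ≤ L²`: `η†` applied to a ground state of the sector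
`(2m, 0)` is a (nonzero) eigenvector with energy `E(2m,0) + U` in the sector `(2m+2, 0)`.
Yang, PRL 63 (1989) 2144, eqs. (5)–(6). [folklore] -/
theorem minEnergyOn_szSector_add_two_le (hL : Even L) (U : ℝ) {m : ℕ} (hm : 2 * m + 2 ≤ L ^ 2) :
    (hubbardTorus 2 L 1 U).minEnergyOn (szSector (2 * (m + 1)) 0) ≤
      (hubbardTorus 2 L 1 U).minEnergyOn (szSector (2 * m) 0) + U := by
  set H := hubbardTorus 2 L 1 U with hHdef
  set E : ℝ := H.minEnergyOn (szSector (2 * (m + 1)) 0) with hEdef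
  set E' : ℝ := H.minEnergyOn (szSector (2 * m) 0) with hE'def
  have hcard : Fintype.card (FermionTorus 2 L) = L ^ 2 := card_fermionTorus 2 L
  have hm1 : m + 1 ≤ Fintype.card (FermionTorus 2 L) := by rw [hcard]; omega
  have hm0 : m ≤ Fintype.card (FermionTorus 2 L) := by omega
  -- a ground state of the lower sector
  obtain ⟨⟨φ, hφmem, hφne, hHφ⟩, -⟩ := szSector_groundState (fermionTorusGraph 2 L) 1 U hm0
  have hHφ' : H *ᵥ φ = ((E' : ℝ) : ℂ) • φ := hHφ
  -- the variational principle in the upper sector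
  have hvar : ∀ χ : Fock (Orb (FermionTorus 2 L)), IsInSector (m + 1) (m + 1) χ →
      E * (star χ ⬝ᵥ χ).re ≤ (star χ ⬝ᵥ (H *ᵥ χ)).re :=
    fun χ hχ => (szSector_groundState (fermionTorusGraph 2 L) 1 U hm1).2 χ hχ
  -- `χ = η† φ` lies in the upper sector
  set χ := etaRaise torusStagger *ᵥ φ with hχdef
  have hφsec : IsInSector m m φ := (mem_szSector_two_mul_zero_iff m φ).1 hφmem
  have hχsec : IsInSector (m + 1) (m + 1) χ := isInSector_etaRaise_mulVec hφsec torusStagger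
  -- Yang's commutator `[H, η†] = U η†`
  have hcomm : H * etaRaise torusStagger =
      etaRaise torusStagger * H + (U : ℂ) • etaRaise torusStagger := by
    have h := etaRaise_commutator_holds (d := 2) (L := L) hL 1 U 0
    rw [hubbardTorusWith_zero, mul_zero, sub_zero] at h
    rw [← h]
    abel
  have hHχ : H *ᵥ χ = ((E' + U : ℝ) : ℂ) • χ := by
    rw [hχdef, mulVec_mulVec, hcomm, add_mulVec, ← mulVec_mulVec, hHφ', mulVec_smul, smul_mulVec,
      ← add_smul, Complex.ofReal_add]
  -- `‖χ‖² = ‖η φ‖² + (L² - 2m) ‖φ‖² > 0`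
  have hφN : IsNParticle (m + m) φ := hφsec.isNParticle
  have hnorm := star_etaRaise_mulVec_dotProduct_self torusStagger hφN
  have hφpos : 0 < (star φ ⬝ᵥ φ).re := (Complex.pos_iff.mp (dotProduct_star_self_pos_iff.2 hφne)).1
  have hηnn : 0 ≤ (star (etaLower torusStagger *ᵥ φ) ⬝ᵥ (etaLower torusStagger *ᵥ φ)).re :=
    (Complex.nonneg_iff.mp (dotProduct_star_self_nonneg _)).1
  have hcoef : ((Fintype.card (FermionTorus 2 L) : ℂ) - ((m + m : ℕ) : ℂ)) =
      (((L : ℝ) ^ 2 - 2 * (m : ℝ) : ℝ) : ℂ) := by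
    rw [hcard]
    push_cast
    ring
  have hcoefpos : 0 < (L : ℝ) ^ 2 - 2 * (m : ℝ) := by
    have h : ((2 * m + 2 : ℕ) : ℝ) ≤ ((L ^ 2 : ℕ) : ℝ) := by exact_mod_cast hm
    push_cast at h
    linarith
  have hχpos : 0 < (star χ ⬝ᵥ χ).re := by
    rw [hχdef, hnorm, hcoef, Complex.add_re, Complex.re_ofReal_mul]
    have := mul_pos hcoefpos hφpos
    linarith
  -- conclude
  have h1 := hvar χ hχsec
  rw [hHχ, dotProduct_smul, smul_eq_mul, Complex.re_ofReal_mul] at h1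
  exact le_of_mul_le_mul_right h1 hχpos

/-- **`EnslavedA1gLowerSandwich` (route `EnslavedA1g`, item 0937).** For `U ≥ 0`, even `L ≥ 3`,
`2 ≤ N ≤ L²` and a normalised ground state `ψ` of `hubbardTorus 2 L 1 U` in the sector
`(N, S^z = 0)`, with `κ = U - (E(N,0) - E(N-2,0))`: (i) `0 ≤ κ` (Yang's `η`-pairing bound);
(ii) `κ ‖P_s ψ‖² ≤ 2 Re⟨P_s ψ, P_{s'} ψ⟩` (sign rule: on-site and extended-`s` pairing are
positively correlated); (iii) `κ² ‖P_s ψ‖² ≤ 4 ‖P_{s'} ψ‖²` (lower sandwich). Proof: by the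
enslaved-A1g identity `2 P_{s'} ψ = (H - E(N,0) + U) P_s ψ` with `P_s ψ ∈ szSector (N-2) 0`, the
variational principle in that sector, and Cauchy–Schwarz. Shastry, J. Phys. A 30 (1997) L635,
Ineqs. (3)–(5) (canonical-sector variant); Zhang, PRB 42 (1990) 1012; Yang, PRL 63 (1989) 2144.
[folklore] -/
theorem enslavedA1gLowerSandwich_proof : EnslavedA1gLowerSandwich := by
  intro U hU L _ hLeven hL N ψ hN2 hNL hψ1 hGS
  obtain ⟨hmem, hne, hHψ⟩ := hGS
  -- `N = 2(m+1)`
  obtain ⟨n, rfl, -⟩ := Summit.HubbardSuperconductivity.HubbardSuperconductivity.Theorems.WcbcsSlater.exists_eq_two_mul_of_mem_szSector_zero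
    hmem hne
  obtain ⟨m, rfl⟩ : ∃ m, n = m + 1 := ⟨n - 1, by omega⟩
  have h2m : 2 * (m + 1) - 2 = 2 * m := by omega
  dsimp only
  rw [h2m]
  set H := hubbardTorus 2 L 1 U with hHdef
  set E : ℝ := H.minEnergyOn (szSector (2 * (m + 1)) 0) with hEdef
  set E' : ℝ := H.minEnergyOn (szSector (2 * m) 0) with hE'def
  set φ' := pairField sWave L *ᵥ ψ with hφ'def
  set v := pairField extendedSWave L *ᵥ ψ with hvdef
  -- (i) Yang's bound
  have hκ : 0 ≤ U - (E - E') := by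
    have := minEnergyOn_szSector_add_two_le (L := L) hLeven U (m := m) (by omega)
    linarith
  -- the variational principle in the lower sector
  have hcard : Fintype.card (FermionTorus 2 L) = L ^ 2 := card_fermionTorus 2 L
  have hm0 : m ≤ Fintype.card (FermionTorus 2 L) := by rw [hcard]; omega
  have hvar : ∀ w : Fock (Orb (FermionTorus 2 L)), IsInSector m m w →
      E' * (star w ⬝ᵥ w).re ≤ (star w ⬝ᵥ (H *ᵥ w)).re :=
    fun w hw => (szSector_groundState (fermionTorusGraph 2 L) 1 U hm0).2 w hw
  -- `P_s ψ ∈ szSector (N-2) 0`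
  have hφ'mem : φ' ∈ szSector (2 * m) 0 := by
    have h := Summit.HubbardSuperconductivity.HubbardSuperconductivity.Theorems.WcbcsSsbToTorusLRO.pairFieldAt_mulVec_mem_szSector
      sWave (0 : TorusSite 2 L) hN2 hmem
    rwa [pairFieldAt_zero, h2m] at h
  have hφ'sec : IsInSector m m φ' := (mem_szSector_two_mul_zero_iff m φ').1 hφ'mem
  -- the enslaved-A1g identity applied to `ψ`: `2 P_{s'} ψ = (H - E + U) P_s ψ`
  have hid := enslavedA1gIdentity_proof L hL U
  have h2v : (2 : ℂ) • v = H *ᵥ φ' - ((E : ℝ) : ℂ) • φ' + (U : ℂ) • φ' := by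
    have h := congrArg (fun M => M *ᵥ ψ) hid
    rw [smul_mulVec, add_mulVec, sub_mulVec, ← mulVec_mulVec, ← mulVec_mulVec, hHψ, mulVec_smul,
      smul_mulVec] at h
    exact h
  -- (ii) in vector form
  have hii : (U - (E - E')) * (star φ' ⬝ᵥ φ').re ≤ 2 * (star φ' ⬝ᵥ v).re := by
    rw [← re_two_smul_dotProduct, h2v, dotProduct_add, dotProduct_sub, dotProduct_smul,
      dotProduct_smul, Complex.add_re, Complex.sub_re, smul_eq_mul, smul_eq_mul,
      Complex.re_ofReal_mul, Complex.re_ofReal_mul]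
    have h1 := hvar φ' hφ'sec
    have h3 : (U - (E - E')) * (star φ' ⬝ᵥ φ').re =
        U * (star φ' ⬝ᵥ φ').re - E * (star φ' ⬝ᵥ φ').re + E' * (star φ' ⬝ᵥ φ').re := by ring
    rw [h3]
    linarith
  refine ⟨hκ, ?_, ?_⟩
  · -- (ii)
    rw [PosSemidefTrace.expect_conjTranspose_mul, PosSemidefTrace.expect_conjTranspose_mul]
    exact hii
  · -- (iii): Cauchy–Schwarz and squaring
    rw [PosSemidefTrace.expect_conjTranspose_mul, PosSemidefTrace.expect_conjTranspose_mul]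
    obtain ⟨nu, nv, hnu, hnv, ha, hb, hCS⟩ := exists_norms_re_star_dotProduct_le φ' v
    rw [ha] at hii ⊢
    rw [hb]
    rcases hnu.eq_or_lt with h0 | hpos
    · rw [← h0]
      have : 0 ≤ 4 * nv ^ 2 := by positivity
      simpa using this
    · have h3 : (U - (E - E')) * nu * nu ≤ 2 * nv * nu := by nlinarith
      have h4 : (U - (E - E')) * nu ≤ 2 * nv := le_of_mul_le_mul_right h3 hpos
      have h5 := pow_le_pow_left₀ (mul_nonneg hκ hnu) h4 2
      nlinarith [h5]

end Main

end Summit.HubbardSuperconductivity.EnslavedA1g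

end
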